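import Summits.Ventures.LatticeQCDFlow.Scoring.FreeFieldLeapfrog
import HarnessLib

/-!
# The energy violation of free-field leapfrog, exactly: `ΔH = (δ²/4)·[S(p_N) − S(p_0)]`

HONEST FRAMING: exact (Metropolis-corrected) sampling algorithms for lattice gauge theory;
figures of merit are autocorrelation/cost numbers at stated couplings and volumes; no
continuum-physics claim.  (SCALAR calibration rung S0-A: not a gauge result.)

Venture `LatticeQCDFlow` (cell pub-lqcd), sub-topic `Scoring`; FANOUT row 2 (`s0-phi4`, the HMC
comparator and the exactness battery).  NEW WORK of the cell (finite sums); nothing is cited as a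
fact.  Printed counterparts, named only: the modified-Hamiltonian analysis of Störmer–Verlet for
quadratic Hamiltonians (Leimkuhler–Reich 2004 ch. 5; Hairer–Lubich–Wanner), Kennedy–Pendleton 1991.

`Scoring/FreeFieldLeapfrog.lean` proved the statement MODE BY MODE (`ΔH = (δ²Ω²/8)(P_N² − P_0²)`
for each eigenmode, which needs the Laplacian eigenbasis).  Here is the same fact at the LATTICE
LEVEL, with no spectral decomposition and for ANY real coupling matrix `J` (symmetric or not):

## What is proved (free action `S(φ) = Σ φJφ` = `latticePhi4Action J 0`, `H = S(φ) + ½Σp²` = `hmcEnergy`)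

* `freePairing J u v = Σ_x u_x F_x(v)` (`F = ∂S/∂φ`, `latticePhi4Force J 0`): symmetric
  (`freePairing_comm` — it is the form of `J + Jᵀ`), bilinear (`freePairing_add_smul_left/right`,
  from `latticePhi4Force_zero_add_smul`), `freePairing_self` `⟪u,u⟫ = 2S(u)` (Euler,
  `sum_mul_latticePhi4Force`), `freePairing_force_self` `⟪F(φ), φ⟫ = |F(φ)|²`;
  `latticePhi4Action_zero_add_smul` — `S(u + cv) = S(u) + c⟪u,v⟫ + c²S(v)`;
  `kinetic_lfKick` — `½|p − δF(φ)|² = ½|p|² − δ⟪p,φ⟫ + (δ²/2)|F(φ)|²`.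
* **`leapfrog_energy_violation`** — for the engine's qpq step `leapfrogQPQ J 0 δ`
  (`Scoring/FreeFieldLeapfrog.lean`) and EVERY `(φ, p)`:
  `H(φ', p') − H(φ, p) = (δ²/4)·(S(p') − S(p))` — the action EVALUATED ON THE MOMENTA, after
  minus before (the `|F|²` terms of the kick and of the second half-drift cancel identically);
  **`leapfrog_iterate_energy_violation`** — along `N` steps it telescopes:
  `H_N − H_0 = (δ²/4)·(S(p_N) − S(p_0))`; `leapfrog_shadow_conserved` — equivalently
  `H̃ = S(φ) + ½|p|² − (δ²/4) S(p)` is conserved EXACTLY.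

Use (exactness battery, integrator leg — a reference-free, statistics-free check of the HMC
kernel the way the 2 × 2 detailed-balance leg checks the Metropolis kernel): run the engine's
leapfrog at `λ = 0` from any `(φ, p)` and compare the measured `ΔH` with `(δ²/4)(S(p_N) − S(p_0))`
computed by the SAME action routine on the momenta — agreement to rounding for every `δ`, `N`,
`m²`, `L` tests force, step order and step-size bookkeeping at once (a kick–drift–kick "pqp"
integrator instead satisfies `ΔH = (δ²/8)(|F(φ_N)|² − |F(φ_0)|²)` by the same algebra — not typed
here — and fails this one at `O(δ²)`, so the leg also identifies the variant).
NOT CLAIMED: `λ > 0` (no closed form); acceptance statistics.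
-/

namespace Summit.Ventures.LatticeQCDFlow.Scoring

open Finset

section Energy

variable {Λ : Type*} [Fintype Λ]

/-- The free pairing `⟪u, v⟫_J = Σ_x u_x F_x(v)` with `F = ∂S/∂φ` the free force
(`= Σ_{x,y} (J_{xy} + J_{yx}) u_x v_y`, the symmetrised coupling form). -/
noncomputable def freePairing (J : Λ → Λ → ℝ) (u v : Λ → ℝ) : ℝ :=
  ∑ x, u x * latticePhi4Force J 0 v x

/-- The free force is linear: `F(u + c v) = F(u) + c F(v)`. -/
theorem latticePhi4Force_zero_add_smul (J : Λ → Λ → ℝ) (u v : Λ → ℝ) (c : ℝ) (x : Λ) :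
    latticePhi4Force J 0 (fun y => u y + c * v y) x
      = latticePhi4Force J 0 u x + c * latticePhi4Force J 0 v x := by
  unfold latticePhi4Force
  simp only [mul_zero, zero_mul, add_zero, mul_add, Finset.sum_add_distrib, Finset.mul_sum]
  congr 1
  exact Finset.sum_congr rfl fun y _ => by ring

/-- The pairing is symmetric (no symmetry of `J` needed: it is the form of `J + Jᵀ`). -/
theorem freePairing_comm (J : Λ → Λ → ℝ) (u v : Λ → ℝ) :
    freePairing J u v = freePairing J v u := by
  unfold freePairing latticePhi4Force
  simp only [mul_zero, zero_mul, add_zero, Finset.mul_sum]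
  rw [Finset.sum_comm]
  refine Finset.sum_congr rfl fun x _ => Finset.sum_congr rfl fun y _ => ?_
  ring

/-- **Euler**: `⟪u, u⟫_J = 2 S(u)` for the free action. -/
theorem freePairing_self (J : Λ → Λ → ℝ) (u : Λ → ℝ) :
    freePairing J u u = 2 * latticePhi4Action J 0 u := by
  unfold freePairing
  rw [sum_mul_latticePhi4Force]
  unfold latticePhi4Action
  ring

/-- The pairing is linear in the second slot. -/
theorem freePairing_add_smul_right (J : Λ → Λ → ℝ) (u v w : Λ → ℝ) (c : ℝ) :
    freePairing J u (fun y => v y + c * w y) = freePairing J u v + c * freePairing J u w := by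
  unfold freePairing
  simp only [latticePhi4Force_zero_add_smul, mul_add, Finset.sum_add_distrib, Finset.mul_sum]
  congr 1
  exact Finset.sum_congr rfl fun x _ => by ring

/-- The pairing is linear in the first slot. -/
theorem freePairing_add_smul_left (J : Λ → Λ → ℝ) (u v w : Λ → ℝ) (c : ℝ) :
    freePairing J (fun y => u y + c * v y) w = freePairing J u w + c * freePairing J v w := by
  rw [freePairing_comm, freePairing_add_smul_right, freePairing_comm J w u, freePairing_comm J w v]

/-- **Quadratic expansion of the free action**: `S(u + c v) = S(u) + c ⟪u, v⟫ + c² S(v)`. -/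
theorem latticePhi4Action_zero_add_smul (J : Λ → Λ → ℝ) (u v : Λ → ℝ) (c : ℝ) :
    latticePhi4Action J 0 (fun y => u y + c * v y)
      = latticePhi4Action J 0 u + c * freePairing J u v + c ^ 2 * latticePhi4Action J 0 v := by
  have h := freePairing_self J (fun y => u y + c * v y)
  rw [freePairing_add_smul_left, freePairing_add_smul_right, freePairing_add_smul_right,
    freePairing_self, freePairing_self, freePairing_comm J v u] at h
  nlinarith [h]

/-- The HMC energy `H(φ, p) = S(φ) + ½ Σ p²` (free action, unit masses). -/
noncomputable def hmcEnergy (J : Λ → Λ → ℝ) (z : (Λ → ℝ) × (Λ → ℝ)) : ℝ :=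
  latticePhi4Action J 0 z.1 + (∑ x, z.2 x ^ 2) / 2

/-- The kinetic term after a kick: `½|p − δF|² = ½|p|² − δ⟪p, φ⟫ + (δ²/2)|F(φ)|²`. -/
theorem kinetic_lfKick (J : Λ → Λ → ℝ) (δ : ℝ) (φ p : Λ → ℝ) :
    (∑ x, lfKick J 0 δ φ p x ^ 2) / 2
      = (∑ x, p x ^ 2) / 2 - δ * freePairing J p φ
        + δ ^ 2 / 2 * ∑ x, latticePhi4Force J 0 φ x ^ 2 := by
  unfold lfKick freePairing
  have h : ∀ x, (p x - δ * latticePhi4Force J 0 φ x) ^ 2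
      = p x ^ 2 - 2 * δ * (p x * latticePhi4Force J 0 φ x)
        + δ ^ 2 * latticePhi4Force J 0 φ x ^ 2 := fun x => by ring
  simp only [h, Finset.sum_add_distrib, Finset.sum_sub_distrib, ← Finset.mul_sum]
  ring

/-- Pairing the force with its own configuration gives the squared force: `⟪F(φ), φ⟫ = |F(φ)|²`. -/
theorem freePairing_force_self (J : Λ → Λ → ℝ) (φ : Λ → ℝ) :
    freePairing J (fun x => latticePhi4Force J 0 φ x) φ = ∑ x, latticePhi4Force J 0 φ x ^ 2 := by
  unfold freePairing
  exact Finset.sum_congr rfl fun x _ => by ring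

/-- **THE ENERGY VIOLATION OF ONE LEAPFROG STEP, EXACTLY** (free field, any real coupling matrix
`J`, any step `δ`): `H(φ', p') − H(φ, p) = (δ²/4)·(S(p') − S(p))` — the action EVALUATED ON THE
MOMENTA, after minus before. -/
theorem leapfrog_energy_violation (J : Λ → Λ → ℝ) (δ : ℝ) (φ p : Λ → ℝ) :
    hmcEnergy J (leapfrogQPQ J 0 δ (φ, p)) - hmcEnergy J (φ, p)
      = δ ^ 2 / 4 * (latticePhi4Action J 0 (leapfrogQPQ J 0 δ (φ, p)).2
          - latticePhi4Action J 0 p) := by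
  -- name the intermediate objects
  set φ₁ : Λ → ℝ := lfDrift (δ / 2) φ p with hφ₁
  set p' : Λ → ℝ := lfKick J 0 δ φ₁ p with hp'
  have hstep : leapfrogQPQ J 0 δ (φ, p) = (lfDrift (δ / 2) φ₁ p', p') := rfl
  rw [hstep]
  simp only [hmcEnergy]
  -- the drifts are `u + c v`
  have hd1 : lfDrift (δ / 2) φ₁ p' = fun y => φ₁ y + (δ / 2) * p' y := rfl
  have hd0 : φ = fun y => φ₁ y + (-(δ / 2)) * p y := by
    funext y
    simp only [hφ₁, lfDrift]
    ring
  have hS' := latticePhi4Action_zero_add_smul J φ₁ p' (δ / 2)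
  have hS0 := latticePhi4Action_zero_add_smul J φ₁ p (-(δ / 2))
  rw [← hd1] at hS'
  rw [← hd0] at hS0
  -- the kick
  have hK := kinetic_lfKick J δ φ₁ p
  rw [← hp'] at hK
  have hpair : freePairing J φ₁ p' = freePairing J φ₁ p - δ * ∑ x, latticePhi4Force J 0 φ₁ x ^ 2 := by
    have e : p' = fun y => p y + (-δ) * latticePhi4Force J 0 φ₁ y := by
      funext y
      simp only [hp', lfKick]
      ring
    rw [e, freePairing_add_smul_right, freePairing_comm J φ₁ (fun y => latticePhi4Force J 0 φ₁ y),
      freePairing_force_self]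
    ring
  rw [hS', hS0, hK, hpair, freePairing_comm J p φ₁]
  ring

/-- **Along a trajectory the violation telescopes**:
`H(φ_N, p_N) − H(φ_0, p_0) = (δ²/4)·(S(p_N) − S(p_0))`, for every `N`. -/
theorem leapfrog_iterate_energy_violation (J : Λ → Λ → ℝ) (δ : ℝ) (N : ℕ)
    (z : (Λ → ℝ) × (Λ → ℝ)) :
    hmcEnergy J ((leapfrogQPQ J 0 δ)^[N] z) - hmcEnergy J z
      = δ ^ 2 / 4 * (latticePhi4Action J 0 ((leapfrogQPQ J 0 δ)^[N] z).2
          - latticePhi4Action J 0 z.2) := by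
  induction N with
  | zero => simp
  | succ N ih =>
      rw [Function.iterate_succ_apply']
      have h := leapfrog_energy_violation J δ ((leapfrogQPQ J 0 δ)^[N] z).1
        ((leapfrogQPQ J 0 δ)^[N] z).2
      rw [Prod.mk.eta] at h
      linear_combination h + ih

/-- **The shadow energy of the lattice**: `H̃(φ, p) = S(φ) + ½|p|² − (δ²/4) S(p)` is conserved
EXACTLY by every leapfrog step (equivalent form of `leapfrog_energy_violation`). -/
theorem leapfrog_shadow_conserved (J : Λ → Λ → ℝ) (δ : ℝ) (φ p : Λ → ℝ) :
    hmcEnergy J (leapfrogQPQ J 0 δ (φ, p))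
        - δ ^ 2 / 4 * latticePhi4Action J 0 (leapfrogQPQ J 0 δ (φ, p)).2
      = hmcEnergy J (φ, p) - δ ^ 2 / 4 * latticePhi4Action J 0 p := by
  have h := leapfrog_energy_violation J δ φ p
  linear_combination h

end Energy

/-! ## The kick–drift–kick (pqp) variant: the dual identity -/

section PQP

variable {Λ : Type*} [Fintype Λ]

/-- One pqp ("kick–drift–kick") leapfrog step of size `δ` (the engine's secondary integrator
`hmcpqp`): half kick, full drift, half kick. -/
noncomputable def leapfrogPQP (J : Λ → Λ → ℝ) (lam δ : ℝ) (z : (Λ → ℝ) × (Λ → ℝ)) :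
    (Λ → ℝ) × (Λ → ℝ) :=
  (lfDrift δ z.1 (lfKick J lam (δ / 2) z.1 z.2),
    lfKick J lam (δ / 2) (lfDrift δ z.1 (lfKick J lam (δ / 2) z.1 z.2))
      (lfKick J lam (δ / 2) z.1 z.2))

/-- **The pqp energy violation, exactly**: `H(φ', p') − H(φ, p) = (δ²/8)·(|F(φ')|² − |F(φ)|²)` —
the squared FORCE after minus before (free field, any real `J`, any `δ`).  Dual to the qpq
identity (`S(p) = ½⟪p,p⟫` there, `½|F(φ)|² = ½⟪F(φ), φ⟫` here); the two variants are told
apart by which identity a trajectory satisfies. -/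
theorem leapfrogPQP_energy_violation (J : Λ → Λ → ℝ) (δ : ℝ) (φ p : Λ → ℝ) :
    hmcEnergy J (leapfrogPQP J 0 δ (φ, p)) - hmcEnergy J (φ, p)
      = δ ^ 2 / 8 * ((∑ x, latticePhi4Force J 0 (leapfrogPQP J 0 δ (φ, p)).1 x ^ 2)
          - ∑ x, latticePhi4Force J 0 φ x ^ 2) := by
  set p₁ : Λ → ℝ := lfKick J 0 (δ / 2) φ p with hp₁
  set φ' : Λ → ℝ := lfDrift δ φ p₁ with hφ'
  have hstep : leapfrogPQP J 0 δ (φ, p) = (φ', lfKick J 0 (δ / 2) φ' p₁) := rfl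
  rw [hstep]
  simp only [hmcEnergy]
  -- drift: `φ' = φ + δ p₁`
  have hd : φ' = fun y => φ y + δ * p₁ y := rfl
  have hS' := latticePhi4Action_zero_add_smul J φ p₁ δ
  rw [← hd] at hS'
  -- the two half kicks
  have hK1 := kinetic_lfKick J (δ / 2) φ p
  rw [← hp₁] at hK1
  have hK2 := kinetic_lfKick J (δ / 2) φ' p₁
  -- pairings
  have hpair1 : freePairing J p₁ φ = freePairing J p φ - δ / 2 * ∑ x, latticePhi4Force J 0 φ x ^ 2 := by
    have e : p₁ = fun y => p y + (-(δ / 2)) * latticePhi4Force J 0 φ y := by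
      funext y
      simp only [hp₁, lfKick]
      ring
    rw [e, freePairing_add_smul_left, freePairing_force_self]
    ring
  have hpair2 : freePairing J p₁ φ' = freePairing J p₁ φ + δ * (2 * latticePhi4Action J 0 p₁) := by
    rw [hd, freePairing_add_smul_right, freePairing_self]
  rw [hK2, hS', hK1, hpair2, freePairing_comm J φ p₁, hpair1]
  ring

/-- Along a pqp trajectory: `H_N − H_0 = (δ²/8)·(|F(φ_N)|² − |F(φ_0)|²)`. -/
theorem leapfrogPQP_iterate_energy_violation (J : Λ → Λ → ℝ) (δ : ℝ) (N : ℕ)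
    (z : (Λ → ℝ) × (Λ → ℝ)) :
    hmcEnergy J ((leapfrogPQP J 0 δ)^[N] z) - hmcEnergy J z
      = δ ^ 2 / 8 * ((∑ x, latticePhi4Force J 0 ((leapfrogPQP J 0 δ)^[N] z).1 x ^ 2)
          - ∑ x, latticePhi4Force J 0 z.1 x ^ 2) := by
  induction N with
  | zero => simp
  | succ N ih =>
      rw [Function.iterate_succ_apply']
      have h := leapfrogPQP_energy_violation J δ ((leapfrogPQP J 0 δ)^[N] z).1
        ((leapfrogPQP J 0 δ)^[N] z).2
      rw [Prod.mk.eta] at h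
      linear_combination h + ih

end PQP

end Summit.Ventures.LatticeQCDFlow.Scoring
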